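import Mathlib
import HarnessLib
import Summits.QuantumFields.YangMills.Theorems.HypercubicLimit.Negative.ReflectedDensity
import Summits.QuantumFields.YangMills.Theorems.FradkinShenkerFlowFiniteSusceptibilityWeakCouplingRPCauchySchwarz
import Literature.MathematicalPhysics.AQFT.OSAxiomsSchwinger
import Literature.MathematicalPhysics.QuantumLattice.LatticeScalarField
import Literature.MathematicalPhysics.QuantumFieldTheory.LatticeGaugeStaticPotentialProofs
import Literature.Probability.LatticeModels.ThermodynamicLimit
import Summits.QuantumFields.YangMills.Theorems.PencilRigidityHypercubicLimitRpBlockHermitian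

/-!
# Block E2-lat: exact Osterwalder–Seiler positivity of the RP-adapted lattice family

Stub `rpBlock_reflectionPositive` of line `conditional-mean-telescoping` (crux stmt-QuantumFields-8646,
c1 seat): the RP-adapted lattice distributions `F ↦ λⁿ ∑_q ∑_x W_q(x) F(centres)` (plaquette `(q, x)` at
`a • (x + (e_i + e_j)/2 − e₀/2)`; temporal corners over `box 4 L`, spatial ones over the time range
`[1 − L, L]`) are EXACTLY reflection positive in the OS sense (`IsReflectionPositive`).  Proof: (1) a
`(deg i + deg j)`-string splits along `Fin.append` (`rp_sum_append`, `rp_term_eq_integral`), so the E2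
term is `∫ B_i · A_j dμ`, `A_j U = λ^{n_j} ∑ F_j(centres) ∏ₖ (plaquette − m)`; (2) corner-reflection
reindexing (`rp_sum_reindex`, `rp_sum_osAdjoint`, with the corner-reflection lemmas `herm_corner_mem`,
`herm_corner_inv`, `herm_point_reflect`, `herm_torusPlaquette_corner` of the landed E0 block; no measure
invariance) gives `B_i U = conj (A_i (Θ U))`;
(3) so the E2 sum is `∫ conj (C (Θ U)) · C U dμ`, `C = ∑ⱼ A_j` (`rp_osForm_eq_integral`); (4) `C` is
bounded, measurable and depends only on the links of `P ∪ M` (each `F_j` is time-ordered, corner times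
`≥ 1`: `rp_dependsOn`), and `wilsonExpectation_oddReflectionPositive` applies. [folklore]
-/

noncomputable section

open scoped SchwartzMap ComplexConjugate
open MeasureTheory
open Literature.MathematicalPhysics.AQFT Literature.MathematicalPhysics.QuantumLattice
open Literature.MathematicalPhysics.QuantumFieldTheory
open Literature.Probability.LatticeModels (box Site)
open Summit.QuantumFields.YangMills.Theorems.HypercubicLimit.Negative (torusPlaquette thetaZ)

namespace Summit.QuantumFields.YangMills.Cruxes.HypercubicLimit.ConditionalMeanTelescoping

/-- Splitting a sum over `(n+m)`-strings (orientations, corners) into pairs along `Fin.append`. -/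
theorem rp_sum_append {ι σ M : Type*} [Fintype ι] [AddCommMonoid M] {n m : ℕ}
    (D : ι → Finset σ) (f : (Fin (n + m) → ι) → (Fin (n + m) → σ) → M) :
    ∑ Q : Fin (n + m) → ι, ∑ X ∈ Fintype.piFinset (fun k => D (Q k)), f Q X =
      ∑ q : Fin n → ι, ∑ q' : Fin m → ι, ∑ x ∈ Fintype.piFinset (fun k => D (q k)),
        ∑ x' ∈ Fintype.piFinset (fun k => D (q' k)), f (Fin.append q q') (Fin.append x x') := by
  rw [← (Fin.appendEquiv n m).sum_comp, Fintype.sum_prod_type]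
  refine Finset.sum_congr rfl fun q _ => Finset.sum_congr rfl fun q' _ => ?_
  simp only [Fin.appendEquiv_apply]
  rw [← Finset.sum_product']
  refine (Finset.sum_equiv (Fin.appendEquiv n m) (fun p => ?_) fun p _ => rfl).symm
  simp only [Finset.mem_product, Fintype.mem_piFinset, Fin.appendEquiv_apply, Fin.forall_fin_add,
    Fin.append_left, Fin.append_right]

/-- Reindexing a string sum by the involution `(q, x) ↦ (q ∘ rev, k ↦ R (x (rev k)))` (`R_q[D q] ⊆ D q`). -/
theorem rp_sum_reindex {ι σ M : Type*} [Fintype ι] [AddCommMonoid M] {n : ℕ}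
    (D : ι → Finset σ) (R : ι → σ → σ) (hRmem : ∀ q y, y ∈ D q → R q y ∈ D q)
    (hRR : ∀ q y, R q (R q y) = y) (f : (Fin n → ι) → (Fin n → σ) → M) :
    ∑ q : Fin n → ι, ∑ x ∈ Fintype.piFinset (fun k => D (q k)), f q x =
      ∑ q : Fin n → ι, ∑ x ∈ Fintype.piFinset (fun k => D (q k)),
        f (q ∘ Fin.rev) (fun k => R (q (Fin.rev k)) (x (Fin.rev k))) := by
  set Φ : (Σ _ : Fin n → ι, Fin n → σ) → (Σ _ : Fin n → ι, Fin n → σ) :=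
    fun p => ⟨p.1 ∘ Fin.rev, fun k => R (p.1 (Fin.rev k)) (p.2 (Fin.rev k))⟩ with hΦ
  rw [Finset.sum_sigma', Finset.sum_sigma']
  refine Finset.sum_nbij' Φ Φ ?_ ?_ ?_ ?_ ?_ <;> rintro ⟨q, x⟩ hp <;>
    simp only [hΦ, Finset.mem_sigma, Finset.mem_univ, true_and, Fintype.mem_piFinset,
      Function.comp_apply] at hp ⊢ <;>
    first | exact fun k => hRmem _ _ (hp _) | simp [Function.comp_def, Fin.rev_rev, hRR]

/-- Measurability of the lattice functional `U ↦ ∑_q ∑_x w_q(x) ∏ₖ T (q k) (x k) U`. -/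
theorem rp_measurable_sum {ι σ Ω : Type*} [Fintype ι] [MeasurableSpace Ω] {n : ℕ}
    (D : ι → Finset σ) (T : ι → σ → Ω → ℝ) (hTm : ∀ q y, Measurable (T q y))
    (w : (Fin n → ι) → (Fin n → σ) → ℂ) :
    Measurable fun U => ∑ q : Fin n → ι, ∑ x ∈ Fintype.piFinset (fun k => D (q k)),
      w q x * ((∏ k, T (q k) (x k) U : ℝ) : ℂ) := by
  refine Finset.measurable_sum _ fun q _ => Finset.measurable_sum _ fun x _ => ?_
  exact (Complex.measurable_ofReal.comp
    (Finset.measurable_prod _ fun k _ => hTm (q k) (x k))).const_mul _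

/-- Boundedness of the lattice functional `U ↦ ∑_q ∑_x w_q(x) ∏ₖ T (q k) (x k) U`. -/
theorem rp_bounded_sum {ι σ Ω : Type*} [Fintype ι] {n : ℕ} (D : ι → Finset σ)
    (T : ι → σ → Ω → ℝ) (hTb : ∀ q y, ∃ C, ∀ U, |T q y U| ≤ C)
    (w : (Fin n → ι) → (Fin n → σ) → ℂ) :
    ∃ B, ∀ U, ‖∑ q : Fin n → ι, ∑ x ∈ Fintype.piFinset (fun k => D (q k)),
      w q x * ((∏ k, T (q k) (x k) U : ℝ) : ℂ)‖ ≤ B := by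
  choose C hC using hTb
  refine ⟨∑ q : Fin n → ι, ∑ x ∈ Fintype.piFinset (fun k => D (q k)), ‖w q x‖ * ∏ k, C (q k) (x k),
    fun U => (norm_sum_le _ _).trans (Finset.sum_le_sum fun q _ => (norm_sum_le _ _).trans
      (Finset.sum_le_sum fun x _ => ?_))⟩
  rw [norm_mul, Complex.norm_real, Real.norm_eq_abs, Finset.abs_prod]
  exact mul_le_mul_of_nonneg_left
    (Finset.prod_le_prod (fun k _ => abs_nonneg _) fun k _ => hC _ _ U) (norm_nonneg _)

/-- **Bilinear splitting**: the `(n+m)`-string sum of `weight × moment × (Fₙ ⊗ G_m)(centres)` is the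
integral of the product of the two lattice functionals. -/
theorem rp_term_eq_integral {ι σ Ω E : Type*} [Fintype ι] [MeasurableSpace Ω]
    (μ : Measure Ω) [IsFiniteMeasure μ] (D : ι → Finset σ) (T : ι → σ → Ω → ℝ)
    (hTm : ∀ q y, Measurable (T q y)) (hTb : ∀ q y, ∃ C, ∀ U, |T q y U| ≤ C) (pt : ι → σ → E)
    {n m : ℕ} (c : ℝ) (Fn : (Fin n → E) → ℂ) (Gm : (Fin m → E) → ℂ) :
    ∑ Q : Fin (n + m) → ι, ∑ X ∈ Fintype.piFinset (fun k => D (Q k)),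
        ((c * ∫ U, ∏ k, T (Q k) (X k) U ∂μ : ℝ) : ℂ) *
          (Fn (fun k => pt (Q (Fin.castAdd m k)) (X (Fin.castAdd m k))) *
            Gm (fun k => pt (Q (Fin.natAdd n k)) (X (Fin.natAdd n k)))) =
      ∫ U, (c : ℂ) * (∑ q : Fin n → ι, ∑ x ∈ Fintype.piFinset (fun k => D (q k)),
          Fn (fun k => pt (q k) (x k)) * ((∏ k, T (q k) (x k) U : ℝ) : ℂ)) *
        (∑ q : Fin m → ι, ∑ x ∈ Fintype.piFinset (fun k => D (q k)),
          Gm (fun k => pt (q k) (x k)) * ((∏ k, T (q k) (x k) U : ℝ) : ℂ)) ∂μ := by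
  have hI : ∀ (Q : Fin (n + m) → ι) (X : Fin (n + m) → σ),
      Integrable (fun U => ((∏ k, T (Q k) (X k) U : ℝ) : ℂ)) μ := fun Q X => by
    choose C hC using fun k => hTb (Q k) (X k)
    refine Integrable.of_bound (Complex.measurable_ofReal.comp
      (Finset.measurable_prod _ fun k _ => hTm (Q k) (X k))).aestronglyMeasurable
      (∏ k, C k) (ae_of_all _ fun U => ?_)
    rw [Complex.norm_real, Real.norm_eq_abs, Finset.abs_prod]
    exact Finset.prod_le_prod (fun k _ => abs_nonneg _) fun k _ => hC k U
  have hterm : ∀ (Q : Fin (n + m) → ι) (X : Fin (n + m) → σ) (w : ℂ),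
      ((c * ∫ U, ∏ k, T (Q k) (X k) U ∂μ : ℝ) : ℂ) * w =
        ∫ U, (c : ℂ) * w * ((∏ k, T (Q k) (X k) U : ℝ) : ℂ) ∂μ := fun Q X w => by
    rw [integral_const_mul, integral_complex_ofReal]; push_cast; ring
  simp_rw [hterm]
  rw [Finset.sum_sigma', ← integral_finsetSum _ fun p _ => (hI p.1 p.2).const_mul _]
  refine integral_congr_ae (ae_of_all _ fun U => ?_)
  simp only [Finset.sum_sigma]
  rw [rp_sum_append D, mul_assoc]
  simp only [Fin.append_left, Fin.append_right, Fin.prod_univ_add, Complex.ofReal_mul,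
    Finset.sum_mul_sum]
  simp only [Finset.mul_sum]
  exact Finset.sum_congr rfl fun q _ => Finset.sum_congr rfl fun q' _ =>
    Finset.sum_congr rfl fun x _ => Finset.sum_congr rfl fun x' _ => by ring

/-- **Corner-reflection reindexing.** The lattice functional of the OS adjoint `Θ F*` at `U` is the
conjugate of the lattice functional of `F` at the reflected configuration `Θ U`. -/
theorem rp_sum_osAdjoint {ι σ Ω : Type*} [Fintype ι] {d n : ℕ} [NeZero d] (D : ι → Finset σ)
    (R : ι → σ → σ) (hRmem : ∀ q y, y ∈ D q → R q y ∈ D q) (hRR : ∀ q y, R q (R q y) = y)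
    (pt : ι → σ → EuclideanSpace ℝ (Fin d)) (hpt : ∀ q y, timeReflection d (pt q (R q y)) = pt q y)
    (T : ι → σ → Ω → ℝ) (Θ : Ω → Ω) (hT : ∀ q y U, T q y (Θ U) = T q (R q y) U)
    (F : 𝓢((Fin n → EuclideanSpace ℝ (Fin d)), ℂ)) (U : Ω) :
    ∑ q : Fin n → ι, ∑ x ∈ Fintype.piFinset (fun k => D (q k)),
        osAdjoint F (fun k => pt (q k) (x k)) * ((∏ k, T (q k) (x k) U : ℝ) : ℂ) =
      conj (∑ q : Fin n → ι, ∑ x ∈ Fintype.piFinset (fun k => D (q k)),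
        F (fun k => pt (q k) (x k)) * ((∏ k, T (q k) (x k) (Θ U) : ℝ) : ℂ)) := by
  have hpt' : ∀ q y, timeReflection d (pt q y) = pt q (R q y) := fun q y => by
    rw [← hpt q (R q y), hRR]
  simp_rw [map_sum, map_mul, Complex.conj_ofReal, hT]
  rw [rp_sum_reindex D R hRmem hRR (fun q x => conj (F fun k => pt (q k) (x k)) *
    ((∏ k, T (q k) (R (q k) (x k)) U : ℝ) : ℂ))]
  refine Finset.sum_congr rfl fun q _ => Finset.sum_congr rfl fun x _ => ?_
  simp only [osAdjoint_apply, Function.comp_apply, hRR, hpt']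
  rw [show ∏ k, T (q (Fin.rev k)) (x (Fin.rev k)) U = ∏ k, T (q k) (x k) U from
    Fintype.prod_equiv Fin.revPerm _ _ fun k => by simp]

/-- **The OS form of the RP-adapted family is a reflection integral**: for tensor witnesses `H i j` of
`Θ(F i)* ⊗ F j`, the E2 double sum is `∫ conj (C (Θ U)) · C U dμ`, `C U = ∑ⱼ λ^{n_j} ∑ F_j(centres) ∏ T`. -/
theorem rp_osForm_eq_integral {ι σ Ω : Type*} [Fintype ι] [MeasurableSpace Ω] {d : ℕ} [NeZero d]
    (μ : Measure Ω) [IsFiniteMeasure μ] (Θ : Ω → Ω) (D : ι → Finset σ) (R : ι → σ → σ)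
    (hRmem : ∀ q y, y ∈ D q → R q y ∈ D q) (hRR : ∀ q y, R q (R q y) = y)
    (pt : ι → σ → EuclideanSpace ℝ (Fin d)) (hpt : ∀ q y, timeReflection d (pt q (R q y)) = pt q y)
    (T : ι → σ → Ω → ℝ) (hT : ∀ q y U, T q y (Θ U) = T q (R q y) U) (hTm : ∀ q y, Measurable (T q y))
    (hTb : ∀ q y, ∃ C, ∀ U, |T q y U| ≤ C) (lam : ℝ) {N : ℕ} (deg : Fin N → ℕ)
    (F : (j : Fin N) → 𝓢((Fin (deg j) → EuclideanSpace ℝ (Fin d)), ℂ))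
    (H : (i j : Fin N) → 𝓢((Fin (deg i + deg j) → EuclideanSpace ℝ (Fin d)), ℂ))
    (hH : ∀ i j, IsAppendTensorOf (H i j) (osAdjoint (F i)) (F j)) :
    ∑ i, ∑ j, ∑ Q : Fin (deg i + deg j) → ι, ∑ X ∈ Fintype.piFinset (fun k => D (Q k)),
        ((lam ^ (deg i + deg j) * ∫ U, ∏ k, T (Q k) (X k) U ∂μ : ℝ) : ℂ) *
          H i j (fun k => pt (Q k) (X k)) =
      ∫ U, conj (∑ j, ((lam ^ deg j : ℝ) : ℂ) * ∑ q : Fin (deg j) → ι,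
          ∑ x ∈ Fintype.piFinset (fun k => D (q k)),
            F j (fun k => pt (q k) (x k)) * ((∏ k, T (q k) (x k) (Θ U) : ℝ) : ℂ)) *
        (∑ j, ((lam ^ deg j : ℝ) : ℂ) * ∑ q : Fin (deg j) → ι,
          ∑ x ∈ Fintype.piFinset (fun k => D (q k)),
            F j (fun k => pt (q k) (x k)) * ((∏ k, T (q k) (x k) U : ℝ) : ℂ)) ∂μ := by
  set g : Fin N → Fin N → Ω → ℂ := fun i j U => ((lam ^ (deg i + deg j) : ℝ) : ℂ) *
      (∑ q : Fin (deg i) → ι, ∑ x ∈ Fintype.piFinset (fun k => D (q k)),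
        osAdjoint (F i) (fun k => pt (q k) (x k)) * ((∏ k, T (q k) (x k) U : ℝ) : ℂ)) *
      (∑ q : Fin (deg j) → ι, ∑ x ∈ Fintype.piFinset (fun k => D (q k)),
        F j (fun k => pt (q k) (x k)) * ((∏ k, T (q k) (x k) U : ℝ) : ℂ)) with hg
  have hA : ∀ i j, (∑ Q : Fin (deg i + deg j) → ι, ∑ X ∈ Fintype.piFinset (fun k => D (Q k)),
      ((lam ^ (deg i + deg j) * ∫ U, ∏ k, T (Q k) (X k) U ∂μ : ℝ) : ℂ) *
        H i j (fun k => pt (Q k) (X k))) = ∫ U, g i j U ∂μ := fun i j => by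
    have hH' : ∀ x, H i j x =
        osAdjoint (F i) (x ∘ Fin.castAdd (deg j)) * F j (x ∘ Fin.natAdd (deg i)) := hH i j
    simp_rw [hH', Function.comp_def]
    exact rp_term_eq_integral μ D T hTm hTb pt _ _ _
  have hI : ∀ i j, Integrable (g i j) μ := fun i j => by
    obtain ⟨B₁, hB₁⟩ := rp_bounded_sum D T hTb
      fun (q : Fin (deg i) → ι) x => osAdjoint (F i) fun k => pt (q k) (x k)
    obtain ⟨B₂, hB₂⟩ := rp_bounded_sum D T hTb fun (q : Fin (deg j) → ι) x => F j fun k => pt (q k) (x k)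
    refine Integrable.of_bound ((((rp_measurable_sum D T hTm _).const_mul _).mul
      (rp_measurable_sum D T hTm _)).aestronglyMeasurable)
      (‖((lam ^ (deg i + deg j) : ℝ) : ℂ)‖ * B₁ * B₂) (ae_of_all _ fun U => ?_)
    simp only [hg]
    rw [norm_mul, norm_mul]
    exact mul_le_mul (mul_le_mul_of_nonneg_left (hB₁ U) (norm_nonneg _)) (hB₂ U) (norm_nonneg _)
      (mul_nonneg (norm_nonneg _) ((norm_nonneg _).trans (hB₁ U)))
  refine (Finset.sum_congr rfl fun i _ => Finset.sum_congr rfl fun j _ => hA i j).trans ?_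
  rw [← show ∫ U, ∑ i, ∑ j, g i j U ∂μ = ∑ i, ∑ j, ∫ U, g i j U ∂μ from by
    rw [integral_finsetSum _ fun i _ => integrable_finsetSum _ fun j _ => hI i j]
    exact Finset.sum_congr rfl fun i _ => integral_finsetSum _ fun j _ => hI i j]
  refine integral_congr_ae (ae_of_all _ fun U => ?_)
  simp only [hg]
  rw [map_sum, Finset.sum_mul_sum]
  refine Finset.sum_congr rfl fun i _ => Finset.sum_congr rfl fun j _ => ?_
  rw [map_mul, Complex.conj_ofReal, ← rp_sum_osAdjoint D R hRmem hRR pt hpt T Θ hT (F i) U]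
  push_cast
  ring

/-- A centre with positive time has corner time `≥ 1` (`a > 0`). -/
theorem rp_corner_pos {a : ℝ} (ha : 0 < a) (q : {q : Fin 4 × Fin 4 // q.1 < q.2}) (y : Fin 4 → ℤ)
    (h : 0 < (a • (siteToE y + (2⁻¹ : ℝ) • (EuclideanSpace.single q.1.1 (1 : ℝ) +
      EuclideanSpace.single q.1.2 (1 : ℝ) - EuclideanSpace.single 0 (1 : ℝ))) :
        EuclideanSpace ℝ (Fin 4)) 0) :
    1 ≤ y 0 := by
  have hj : (0 : Fin 4) ≠ q.1.2 := (lt_of_le_of_lt (Fin.zero_le _) q.2).ne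
  simp only [PiLp.smul_apply, PiLp.add_apply, PiLp.sub_apply, PiLp.single_apply, siteToE_apply,
    smul_eq_mul, if_neg hj, ↓reduceIte] at h
  have h' := (mul_pos_iff_of_pos_left ha).1 h
  have h0 : (0 : ℝ) < y 0 := by
    by_cases hi : (0 : Fin 4) = q.1.1 <;> [rw [if_pos hi] at h'; rw [if_neg hi] at h'] <;> linarith
  have : (0 : ℤ) < y 0 := by exact_mod_cast h0
  omega

/-- **The four links of a plaquette with corner time in `[1, L]` lie in `P ∪ M`** (odd torus of side
`2L+1`; `P` = links based at times `1 … L`, `M` = spatial links at time `L+1`). -/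
theorem rp_edges_subset {L : ℕ} [Fact (1 < 2 * L + 1)] {i j : Fin 4} (hij : i < j) {y : Fin 4 → ℤ}
    (h1 : 1 ≤ y 0) (hyL : y 0 ≤ L) :
    ({torusEdge (2 * L + 1) (y, i), torusEdge (2 * L + 1) (y + Pi.single i 1, j),
        torusEdge (2 * L + 1) (y + Pi.single j 1, i), torusEdge (2 * L + 1) (y, j)} :
          Set (Edge 4 (2 * L + 1))) ⊆
      ((WilsonOddRP.oPosEdges ∪ WilsonOddRP.oSharedEdges : Finset (Edge 4 (2 * L + 1))) :
        Set (Edge 4 (2 * L + 1))) := by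
  obtain ⟨t, ht⟩ : ∃ t : ℕ, y 0 = t := ⟨(y 0).toNat, (Int.toNat_of_nonneg (by omega)).symm⟩
  have ht' : 1 ≤ t ∧ t ≤ L := ⟨by omega, by omega⟩
  have hj0 : j ≠ 0 := (lt_of_le_of_lt (Fin.zero_le _) hij).ne'
  have hL2 : (2 * L + 1) / 2 = L := by omega
  have hv : ∀ z : Fin 4 → ℤ, z 0 = t →
      (Literature.Probability.LatticeModels.Torus.proj (2 * L + 1) z 0).val = t := fun z hz =>
    Theorems.HypercubicLimit.Negative.val_proj_zero hz (by omega)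
  intro e he
  simp only [Set.mem_insert_iff, Set.mem_singleton_iff] at he
  rw [Finset.coe_union, Set.mem_union, Finset.mem_coe, Finset.mem_coe, WilsonOddRP.mem_oPosEdges,
    WilsonOddRP.mem_oSharedEdges, WilsonOddRP.IsOPosEdge, WilsonOddRP.IsOSharedEdge, hL2]
  rcases he with rfl | rfl | rfl | rfl <;> simp only [torusEdge]
  · rw [hv y ht]; exact Or.inl ht'
  · by_cases hi : i = 0
    · subst hi
      rw [Theorems.HypercubicLimit.Negative.val_proj_zero (x := y + Pi.single (0 : Fin 4) 1)
        (t := t + 1) (by simp [ht]) (by omega)]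
      rcases Nat.lt_or_ge t L with h | h
      exacts [Or.inl ⟨by omega, h⟩, Or.inr ⟨hj0, by omega⟩]
    · rw [hv _ (by simp [ht, Ne.symm hi])]; exact Or.inl ht'
  · rw [hv _ (by simp [ht, hj0.symm])]; exact Or.inl ht'
  · rw [hv y ht]; exact Or.inl ht'

/-- **`P ∪ M`-dependence of the lattice functional of a time-ordered test function**: terms whose
centre string is not time-positive vanish; plaquettes with corner time in `[1, L]` live on `P ∪ M`. -/
theorem rp_dependsOn {G : Type} [Group G] [TopologicalSpace G] (r : LatticeRep G) {L : ℕ}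
    [Fact (1 < 2 * L + 1)] {a : ℝ} (ha : 0 < a) (m : {q : Fin 4 × Fin 4 // q.1 < q.2} → ℝ) {n : ℕ}
    (F : 𝓢((Fin n → EuclideanSpace ℝ (Fin 4)), ℂ)) (hF : IsTimeOrdered F) :
    DependsOn (fun U : GaugeConfig 4 (2 * L + 1) G =>
        ∑ q : Fin n → {q : Fin 4 × Fin 4 // q.1 < q.2},
          ∑ x ∈ Fintype.piFinset (fun k => if (q k).1.1 = 0 then box 4 L
              else (box 4 L).filter (fun y => 1 - (L : ℤ) ≤ y 0)),
            F (fun k => a • (siteToE (x k) + (2⁻¹ : ℝ) • (EuclideanSpace.single (q k).1.1 (1 : ℝ) +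
              EuclideanSpace.single (q k).1.2 (1 : ℝ) - EuclideanSpace.single 0 (1 : ℝ)))) *
              ((∏ k, (torusPlaquette r (2 * L + 1) (q k).1.1 (q k).1.2 (x k) U - m (q k)) : ℝ) : ℂ))
      ((WilsonOddRP.oPosEdges ∪ WilsonOddRP.oSharedEdges : Finset (Edge 4 (2 * L + 1))) :
        Set (Edge 4 (2 * L + 1))) := by
  intro U V hUV
  refine Finset.sum_congr rfl fun q _ => Finset.sum_congr rfl fun x hx =>
    mul_eq_mul_left_iff.2 (or_iff_not_imp_right.2 fun h0 => ?_)
  congr 1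
  refine Finset.prod_congr rfl fun k _ => ?_
  have h1 : 1 ≤ x k 0 :=
    rp_corner_pos ha (q k) (x k) ((hF (subset_tsupport _ (Function.mem_support.2 h0))).1 k)
  have h2 : x k 0 ≤ L := by
    have hk := Fintype.mem_piFinset.1 hx k
    split_ifs at hk
    exacts [((Literature.Probability.LatticeModels.mem_box.1 hk) 0).2,
      ((Literature.Probability.LatticeModels.mem_box.1 (Finset.mem_filter.1 hk).1) 0).2]
  rw [Theorems.HypercubicLimit.Negative.dependsOn_torusPlaquette r (2 * L + 1) _ _ (x k)
    fun e he => hUV e (rp_edges_subset (q k).2 h1 h2 he)]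

/-- **Block E2-lat (exact Osterwalder–Seiler positivity of the RP-adapted family).** For `β ≥ 0`,
`L ≥ 1`, `a > 0` the RP-adapted lattice family is EXACTLY reflection positive in the OS sense
(`IsReflectionPositive`): after the corner-reflection reindexing the E2 sum is `∫ conj (C (Θ U)) · C U dμ`
for a bounded measurable `C` living on `P ∪ M`, and `wilsonExpectation_oddReflectionPositive` applies. -/
theorem rpBlock_reflectionPositive :
    ∀ (G : Type) [Group G] [TopologicalSpace G] [IsTopologicalGroup G] [CompactSpace G]
      [MeasurableSpace G] [BorelSpace G] (r : LatticeRep G) (β : ℝ) (L : ℕ) (a lam : ℝ)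
      (m : {q : Fin 4 × Fin 4 // q.1 < q.2} → ℝ), 0 ≤ β → 1 ≤ L → 0 < a →
      (SchwingerFamily.toLabelled
        ((fun n => ∑ q : Fin n → {q : Fin 4 × Fin 4 // q.1 < q.2},
            ∑ x ∈ Fintype.piFinset (fun k => if (q k).1.1 = 0 then box 4 L
                else (box 4 L).filter (fun y => 1 - (L : ℤ) ≤ y 0)),
              (((lam ^ n * ∫ U, ∏ k, (torusPlaquette r (2 * L + 1) (q k).1.1 (q k).1.2 (x k) U - m (q k))
                  ∂(wilsonMeasure r.ρ β : Measure (GaugeConfig 4 (2 * L + 1) G)) : ℝ) : ℂ)) •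
                LabelledSchwingerFamily.evalAt (fun k => a • (siteToE (x k) +
                  (2⁻¹ : ℝ) • (EuclideanSpace.single (q k).1.1 (1 : ℝ) + EuclideanSpace.single (q k).1.2 (1 : ℝ)
                    - EuclideanSpace.single 0 (1 : ℝ))))) :
          SchwingerFamily (EuclideanSpace ℝ (Fin 4)))).IsReflectionPositive := by
  intro G _ _ _ _ _ _ r β L a lam m hβ hL ha N deg lab F hF H hH
  simp only [SchwingerFamily.toLabelled_apply, _root_.sum_apply, _root_.smul_apply,
    LabelledSchwingerFamily.evalAt_apply, smul_eq_mul]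
  haveI := isProbabilityMeasure_wilsonMeasure (d := 4) (L := 2 * L + 1) r.ρ r.continuous β
  haveI : Fact (1 < 2 * L + 1) := ⟨by omega⟩
  set D : {q : Fin 4 × Fin 4 // q.1 < q.2} → Finset (Fin 4 → ℤ) := fun q =>
    if q.1.1 = 0 then box 4 L else (box 4 L).filter (fun y => 1 - (L : ℤ) ≤ y 0)
  set T : {q : Fin 4 × Fin 4 // q.1 < q.2} → (Fin 4 → ℤ) → GaugeConfig 4 (2 * L + 1) G → ℝ :=
    fun q y U => torusPlaquette r (2 * L + 1) q.1.1 q.1.2 y U - m q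
  set pt : {q : Fin 4 × Fin 4 // q.1 < q.2} → (Fin 4 → ℤ) → EuclideanSpace ℝ (Fin 4) := fun q y =>
    a • (siteToE y + (2⁻¹ : ℝ) • (EuclideanSpace.single q.1.1 (1 : ℝ) +
      EuclideanSpace.single q.1.2 (1 : ℝ) - EuclideanSpace.single 0 (1 : ℝ)))
  have hTm : ∀ q y, Measurable (T q y) := fun q y =>
    (Theorems.HypercubicLimit.Negative.measurable_torusPlaquette r _ _ _ y).sub measurable_const
  have hTb : ∀ q y, ∃ C, ∀ U, |T q y U| ≤ C := fun q y => ⟨r.N + |m q|, fun U =>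
    (abs_sub _ _).trans (add_le_add (abs_plaquetteObs_le_holds (ρ := r.ρ) r.mem_unitary y q.1.1
      q.1.2 (torusLift (2 * L + 1) U)) le_rfl)⟩
  have key := rp_osForm_eq_integral (wilsonMeasure r.ρ β : Measure (GaugeConfig 4 (2 * L + 1) G))
    GaugeConfig.timeReflect D (fun q y => if q.1.1 = 0 then thetaZ y - Pi.single 0 1 else thetaZ y)
    (herm_corner_mem L) herm_corner_inv pt (herm_point_reflect a) T
    (fun q y U => congrArg (· - m q) (herm_torusPlaquette_corner r _ q y U).symm) hTm hTb lam deg F H hH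
  set C : GaugeConfig 4 (2 * L + 1) G → ℂ := fun U => ∑ j, ((lam ^ deg j : ℝ) : ℂ) *
    ∑ q : Fin (deg j) → {q : Fin 4 × Fin 4 // q.1 < q.2}, ∑ x ∈ Fintype.piFinset (fun k => D (q k)),
      F j (fun k => pt (q k) (x k)) * ((∏ k, T (q k) (x k) U : ℝ) : ℂ) with hC
  have hCm : Measurable C :=
    hC ▸ Finset.measurable_sum _ fun j _ => (rp_measurable_sum D T hTm _).const_mul _
  have hCb : ∃ B : ℝ, ∀ U, ‖C U‖ ≤ B := by
    choose B hB using fun j => rp_bounded_sum D T hTb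
      fun (q : Fin (deg j) → {q : Fin 4 × Fin 4 // q.1 < q.2}) x => F j fun k => pt (q k) (x k)
    refine ⟨∑ j, ‖((lam ^ deg j : ℝ) : ℂ)‖ * B j, fun U => ?_⟩
    rw [hC]
    exact (norm_sum_le _ _).trans (Finset.sum_le_sum fun j _ => (norm_mul_le _ _).trans
      (mul_le_mul_of_nonneg_left (hB j U) (norm_nonneg _)))
  have hCdep : DependsOn C ((WilsonOddRP.oPosEdges ∪ WilsonOddRP.oSharedEdges :
      Finset (Edge 4 (2 * L + 1))) : Set (Edge 4 (2 * L + 1))) := fun U V hUV => by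
    rw [hC]
    exact Finset.sum_congr rfl fun j _ =>
      congrArg (((lam ^ deg j : ℝ) : ℂ) * ·) (rp_dependsOn r ha m (F j) (hF j) hUV)
  have hpos := wilsonExpectation_oddReflectionPositive (d := 4) (L := 2 * L + 1) r.ρ ⟨L, rfl⟩
    (by omega) r.continuous hβ C hCm hCb hCdep
  have key' := key.trans (show _ = wilsonExpectation (d := 4) (L := 2 * L + 1) r.ρ β
    (fun U => conj (C U.timeReflect) * C U) from rfl)
  obtain ⟨h1, h2⟩ := Complex.nonneg_iff.1 hpos
  rw [← key'] at h1 h2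
  exact ⟨h1, h2.symm⟩

end Summit.QuantumFields.YangMills.Cruxes.HypercubicLimit.ConditionalMeanTelescoping

end
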